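import Literature.NumberTheory.PAdicHodge.TatePairingPointOfKTwoMatching
import Literature.NumberTheory.PAdicHodge.KummerCocycleMatchingO
import Literature.NumberTheory.EllipticCurves.LocalTatePairingKummerTadic
import HarnessLib

/-!
# Kato's reciprocity law modulo (K₂) on a good `𝒪_D`-model: the CANONICAL matching, the `T`-adic Kummer cocycle and the K1 integrating
# pair discharged (gap 2a of the capstone closed)

Topic `Literature/NumberTheory/PAdicHodge`; THEOREMS ONLY (no definition, no named fact, no instance, no `sorry`). Sequel of
`TatePairingPointOfKTwoMatching` (★★★ `exists_const_tatePairingPoint_eq_neg_trace_of_KTwo_of_matching`: at `F = K_v`, along an ABSTRACT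
equivariant matching `em : T_pW ≃ T_pŴ♭(𝒪_ℂ)`, for every cocycle `κ` WITH the level Kummer classes of `P` and every integrating pair
`(b_ω, b_η)` of `κ`: (K₂) ⟹ Kato's formula at `(η, P)`), memo
`Summits/BirchSwinnertonDyer/BirchSwinnertonDyer/Cruxes/StarredOptimalManinUnitFiveSeven/Lines/kato-lever-K3-legendre.md` §4/§6.
Here the bookkeeping hypotheses are DISCHARGED on the good `𝒪_D`-models `E = curveFO F W♭` (`W♭ = W_D ⊗_ψ 𝒪_F`, good supersingular
reduction at the odd residue characteristic `p` — the currency of the K★ cells), `K₀ := F = K_v`: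

* §1 ★ `exists_const_tatePairingPoint_eq_neg_trace_of_KTwo_canonical` — the capstone along the CANONICAL matching
  `em = θ_∞ ≫ e` (`θ_∞ = tateModuleEquiv E F p : T_pE|_{Γ_F} ⥲ T_p(E ×_F F)`, `TateModuleBaseChange`; `e = AinfTop.tateGeomEquivTatePtOSS`,
  `AinfWeierstrassTateModuleGeomO`): its equivariance `hem` along `absGaloisRestrict F F` is `tateModuleEquiv_smul` + `tateGeomEquivTatePtOSS_smul`.
* §2 `omegaPeriodHomO_em_tadicKummer` / `etaPeriodHomO_em_tadicKummer` — for a `p`-power division sequence `Q` of a FORMAL point `P ∈ E₁(F)`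
  with `𝒪_D`-rational parameter `c`, the `T`-adic Kummer cocycle `κ_Q` of `LocalTatePairingKummerTadic` (`κ_Q(σ) = θ_∞⁻¹((σQₙ − Qₙ)ₙ)`, level
  classes = `kummerLevelClass … P`) is carried by `em` to K1's `κ_u` (`tateGeomEquivTatePtOSS_kummer`, `uₙ = z(Qₙ)`), so K1's pair
  `(bOmega, bEta)` at the constant lift `coeffPt c` INTEGRATES it: `∫ω(em(κ_Q τ)) = τ b_ω − b_ω`, `∫η(em(κ_Q τ)) = τ b_η − b_η`
  (`gal_bOmega_sub_bOmega_eq_omegaPeriodHomO`, `gal_bEta_sub_bEta_eq_etaPeriodHomO`); shifting `b_ω` by the `Γ_F`-invariant constant `ι(c_P)`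
  keeps this and gives `θ(b_ω + ι c_P) = c_P` (`θ(bOmega) = 0`); `b_η` may likewise be shifted by any invariant `ι(c'_P)` (the crystalline
  `η`-integral need not be K1's `bEta` on the nose — memo §7.3 (i)).
* §3 ★★★ `tatePairingPoint_eq_neg_trace_of_KTwo_formalPoint` — **Kato's formula at `(η, P)` for every formal point `P ∈ E₁(F)` with
  `𝒪_D`-rational parameter, GRANTED ONLY (K₂) for the explicit pair `(bOmega + ι c_P, bEta + ι c'_P)`** (cochain form `hX` + smallness `hXsmall`, the
  hypotheses of `RecognitionFromTeichLog`): `⟨[η], P⟩ = −Tr_{F/ℚ_p}(c_P · exp*_d(η) · c)`, ONE pair of constants `(c_L, c)` for all `(η, P)`.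
  No matching, no cocycle, no integrating-pair hypothesis is left; the remaining inputs are the cell data ((N1′), (Nη), the Weil tower, the
  de Rham binders `hinj`/`hde`/`d`, `ψ = log χ`) and (K₂). With `c_P := log_ω P` (the value for which (K₂) is Kato's Lemma 1.4.3 / BK Ex. 3.11)
  this is [REC] at `(η, P)` modulo (K₂); other points by the index step and `ReciprocityFormulaOffLevel`.

BSD / K★ (`stmt-BirchSwinnertonDyer-22226`) / [REC] are NOT proved by this file; (K₂) is the research residue (memo §2/§5).

## References
* K. Kato, LNM 1553 (1993), Ch. II Thm. 1.4.1, Lemma 1.4.3. [Kato1993LNM1553]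
* S. Bloch, K. Kato (1990), Ex. 3.10.1, Example 3.11. [BlochKato1990]
* J. H. Silverman, *AEC* (2009), Prop. VII.2.1–VII.2.2, VIII §2. [SilvermanAEC2009]
-/

noncomputable section

open Field Function ValuativeRel WittVector NumberField IsDedekindDomain
open scoped NumberField Topology

namespace Literature.NumberTheory.PAdicHodge

open Literature.NumberTheory.GaloisRepresentations
open Literature.NumberTheory.GaloisRepresentations.IsNonarchimedeanLocalField
open Literature.NumberTheory.GaloisRepresentations.LubinTate
open Literature.NumberTheory.GaloisCohomology
open Literature.NumberTheory.EllipticCurves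
open Literature.NumberTheory.EllipticCurves.FormalGroupChart
open Literature.NumberTheory.PAdicHodge.GaloisContinuity
open Literature.IUT.LogVolume
open _root_.WeierstrassCurve

section Completion

variable {K : Type} [Field K] [NumberField K] {p : ℕ} [hprime : Fact p.Prime] (v : HeightOneSpectrum (𝓞 K))
  [CharZero (v.adicCompletion K)] [LocallyCompactSpace (absoluteGaloisGroup (v.adicCompletion K))]
  [Fact (¬ IsUnit (p : integerC (v.adicCompletion K)))]
  [IsAdicComplete (Ideal.span {(p : integerC (v.adicCompletion K))}) (integerC (v.adicCompletion K))]
  [CharP 𝓀[v.adicCompletion K] p]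
  (hpv : valuation (v.adicCompletion K) (p : v.adicCompletion K) < 1)
  (Dv : EisensteinRoot (v.adicCompletion K) p hpv) (Wm : WeierstrassCurve (EisensteinRoot.CoeffDisc Dv))
  (ψm : EisensteinRoot.CoeffDisc Dv →+* LTCoeff (v.adicCompletion K))
  (hψm : ∀ c, algebraMap (LTCoeff (v.adicCompletion K)) (v.adicCompletion K) (ψm c) = EisensteinRoot.CoeffDisc.toF Dv c)
  (hp2 : p ≠ 2) (hΔ : IsUnit (Wm.map ψm).Δ) (hA : ((Wm.map ψm).map (AinfTop.redCoeff (v.adicCompletion K))).hasseCoeff p = 0)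
  [(AinfTop.curveFO (v.adicCompletion K) (Wm.map ψm)).IsElliptic]
  [(curveOver (CompletedAlgClosure (v.adicCompletion K)) (Wm.map ψm)).IsElliptic]
  (e : (k : ℕ) → geomTorsion (AinfTop.curveFO (v.adicCompletion K) (Wm.map ψm)) ((p ^ k : ℕ) : ℤ) →
    geomTorsion (AinfTop.curveFO (v.adicCompletion K) (Wm.map ψm)) ((p ^ k : ℕ) : ℤ) → AlgebraicClosure (v.adicCompletion K))
  (hμ : ∀ k S T, e k S T ^ (p ^ k) = 1) (hadd₁ : ∀ k S₁ S₂ T, e k (S₁ + S₂) T = e k S₁ T * e k S₂ T)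
  (hadd₂ : ∀ k S T₁ T₂, e k S (T₁ + T₂) = e k S T₁ * e k S T₂)
  (hgal : ∀ k (σ : absoluteGaloisGroup (v.adicCompletion K))
    (S T : geomTorsion (AinfTop.curveFO (v.adicCompletion K) (Wm.map ψm)) ((p ^ k : ℕ) : ℤ)), σ • e k S T = e k (σ • S) (σ • T))
  (hcompat : ∀ k (S T : geomTorsion (AinfTop.curveFO (v.adicCompletion K) (Wm.map ψm)) ((p ^ (k + 1) : ℕ) : ℤ)),
    e k (torsionMulHom (AinfTop.curveFO (v.adicCompletion K) (Wm.map ψm)) (p ^ (k + 1)) (p ^ k) p (pow_succ p k).symm S)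
      (torsionMulHom (AinfTop.curveFO (v.adicCompletion K) (Wm.map ψm)) (p ^ (k + 1)) (p ^ k) p (pow_succ p k).symm T) =
        e (k + 1) S T ^ p)

/-! ### §1 The capstone along the canonical matching -/

omit [LocallyCompactSpace (absoluteGaloisGroup (HeightOneSpectrum.adicCompletion K v))] [Fact (¬ IsUnit (p : integerC (v.adicCompletion K)))]
  [IsAdicComplete (Ideal.span {(p : integerC (v.adicCompletion K))}) (integerC (v.adicCompletion K))]
  [(curveOver (CompletedAlgClosure (v.adicCompletion K)) (Wm.map ψm)).IsElliptic] in
/-- **Equivariance of the canonical matching** `em = θ_∞ ≫ e : T_pE|_{Γ_F} ⥲ T_pŴ♭(𝒪_ℂ)` along `absGaloisRestrict F F` (the action of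
`restrictedTateRep E F p`): `tateModuleEquiv_smul` + `tateGeomEquivTatePtOSS_smul`. [cite: SilvermanAEC2009, III §7] -/
theorem em_canonical_smul (σ : absoluteGaloisGroup (v.adicCompletion K))
    (a : (AinfTop.curveFO (v.adicCompletion K) (Wm.map ψm)).tateModule p) :
    ((tateModuleEquiv (AinfTop.curveFO (v.adicCompletion K) (Wm.map ψm)) (v.adicCompletion K) p).trans
        (AinfTop.tateGeomEquivTatePtOSS (v.adicCompletion K) (Wm.map ψm) p hp2 hΔ hA))
        (absGaloisRestrict (v.adicCompletion K) (v.adicCompletion K) σ • a) =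
      σ • ((tateModuleEquiv (AinfTop.curveFO (v.adicCompletion K) (Wm.map ψm)) (v.adicCompletion K) p).trans
        (AinfTop.tateGeomEquivTatePtOSS (v.adicCompletion K) (Wm.map ψm) p hp2 hΔ hA)) a := by
  rw [LinearEquiv.trans_apply, LinearEquiv.trans_apply, tateModuleEquiv_smul]
  exact AinfTop.tateGeomEquivTatePtOSS_smul (Wm.map ψm) hp2 hΔ hA σ _

omit [(curveOver (CompletedAlgClosure (v.adicCompletion K)) (Wm.map ψm)).IsElliptic] in
/-- ★ **The capstone along the CANONICAL matching.** `exists_const_tatePairingPoint_eq_neg_trace_of_KTwo_of_matching` for the good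
`𝒪_D`-model `E = curveFO F W♭` over `K₀ := F = K_v`, with `em := θ_∞ ≫ e` (`tateModuleEquiv` ≫ `tateGeomEquivTatePtOSS`) — the matching
hypothesis `hem` DISCHARGED (`em_canonical_smul`). Statement otherwise verbatim (period maps `∫ω ∘ em`, `∫η ∘ em`).
[cite: Kato1993LNM1553, Ch. II Thm. 1.4.1 (3)–(4) and Lemma 1.4.3] [cite: SilvermanAEC2009, III §7] -/
theorem exists_const_tatePairingPoint_eq_neg_trace_of_KTwo_canonical
    (hN1 : ∃ τ, AinfRamTop.omegaPeriodHomO Wm ψm (surjective_fontaineTheta_integerC hpv) hψm τ ≠ 0)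
    (hNη : ∃ τ, AinfRamTop.etaPeriodHomO Wm ψm (surjective_fontaineTheta_integerC hpv) hψm τ ∉ (BdRPlusTop.filOne (v.adicCompletion K) p).toIdeal)
    (ψ : C(absoluteGaloisGroup (v.adicCompletion K), ℤ_[p])) (hψ : ∀ σ τ, ψ (σ * τ) = ψ σ + ψ τ)
    (hψlog : ∀ τ, (ψ τ : ℚ_[p]) = logCyclotomic (F := (v.adicCompletion K)) p τ)
    (heL : ∀ (c : ℤ_[p]) (S U : (AinfTop.curveFO (v.adicCompletion K) (Wm.map ψm)).tateModule p), (weilContPairingPadic (AinfTop.curveFO (v.adicCompletion K) (Wm.map ψm)) (v.adicCompletion K) p e hμ hadd₁ hadd₂ hgal hcompat).toLin (c • S) U =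
      twistHom (v.adicCompletion K) p ((weilContPairingPadic (AinfTop.curveFO (v.adicCompletion K) (Wm.map ψm)) (v.adicCompletion K) p e hμ hadd₁ hadd₂ hgal hcompat).toLin S U) c)
    (healt : ∀ S : (AinfTop.curveFO (v.adicCompletion K) (Wm.map ψm)).tateModule p, (weilContPairingPadic (AinfTop.curveFO (v.adicCompletion K) (Wm.map ψm)) (v.adicCompletion K) p e hμ hadd₁ hadd₂ hgal hcompat).toLin S S = 0)
    (henondeg : ∀ S : (AinfTop.curveFO (v.adicCompletion K) (Wm.map ψm)).tateModule p,
      (∀ U, (weilContPairingPadic (AinfTop.curveFO (v.adicCompletion K) (Wm.map ψm)) (v.adicCompletion K) p e hμ hadd₁ hadd₂ hgal hcompat).toLin S U = 0) → S = 0)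
    (hinj : letI := LocalField.padicAlgebra (v.adicCompletion K) p hpv
      (bdRPeriodRingData (F := (v.adicCompletion K)) (p := p) hpv).CupLogInjective (logCyclotomic p) (restrictedRationalTateRep (AinfTop.curveFO (v.adicCompletion K) (Wm.map ψm)) (v.adicCompletion K) p))
    (hde : letI := LocalField.padicAlgebra (v.adicCompletion K) p hpv
      ∀ η : contOneCocycles (restrictedTateRep (AinfTop.curveFO (v.adicCompletion K) (Wm.map ψm)) (v.adicCompletion K) p).toTopRep,
        (bdRPeriodRingData (F := (v.adicCompletion K)) (p := p) hpv).HasDualExp (logCyclotomic p) (restrictedRationalTateRep (AinfTop.curveFO (v.adicCompletion K) (Wm.map ψm)) (v.adicCompletion K) p)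
          fun σ => TateModule.toRational p (η.1 σ))
    (d : letI := LocalField.padicAlgebra (v.adicCompletion K) p hpv
      (bdRPeriodRingData (F := (v.adicCompletion K)) (p := p) hpv).FilZeroLine (restrictedRationalTateRep (AinfTop.curveFO (v.adicCompletion K) (Wm.map ψm)) (v.adicCompletion K) p)) :
    letI := LocalField.padicAlgebra (v.adicCompletion K) p hpv
    let hF := surjective_fontaineTheta_integerC hpv
    let em : (AinfTop.curveFO (v.adicCompletion K) (Wm.map ψm)).tateModule p ≃ₗ[ℤ_[p]] AinfTop.TatePtO (v.adicCompletion K) (Wm.map ψm) p :=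
      (tateModuleEquiv (AinfTop.curveFO (v.adicCompletion K) (Wm.map ψm)) (v.adicCompletion K) p).trans (AinfTop.tateGeomEquivTatePtOSS (v.adicCompletion K) (Wm.map ψm) p hp2 hΔ hA)
    let Pω : (AinfTop.curveFO (v.adicCompletion K) (Wm.map ψm)).tateModule p →+ BdRPlusTop (v.adicCompletion K) p := (AinfRamTop.omegaPeriodHomO Wm ψm hF hψm).comp em.toAddMonoidHom
    let Pη : (AinfTop.curveFO (v.adicCompletion K) (Wm.map ψm)).tateModule p →+ BdRPlusTop (v.adicCompletion K) p := (AinfRamTop.etaPeriodHomO Wm ψm hF hψm).comp em.toAddMonoidHom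
    ∃ (cL c : (v.adicCompletion K)), cL ≠ 0 ∧
      (∀ S U : (AinfTop.curveFO (v.adicCompletion K) (Wm.map ψm)).tateModule p, Pω S * Pη U - Pη S * Pω U = BdRPlusTop.of (v.adicCompletion K) p (embBdRHom hpv hF cL) *
        BdRPlusTop.periodLine (v.adicCompletion K) p ((weilContPairingPadic (AinfTop.curveFO (v.adicCompletion K) (Wm.map ψm)) (v.adicCompletion K) p e hμ hadd₁ hadd₂ hgal hcompat).toLin S U)) ∧
      ∀ (η κ : contOneCocycles (restrictedTateRep (AinfTop.curveFO (v.adicCompletion K) (Wm.map ψm)) (v.adicCompletion K) p).toTopRep) (P : ((AinfTop.curveFO (v.adicCompletion K) (Wm.map ψm)).baseChange (v.adicCompletion K)).toAffine.Point),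
        (∀ j, (cohomologyMap (tateProjMor (AinfTop.curveFO (v.adicCompletion K) (Wm.map ψm)) (v.adicCompletion K) p j) 1).hom (oneCocycleClass _ κ) = kummerLevelClass (AinfTop.curveFO (v.adicCompletion K) (Wm.map ψm)) (v.adicCompletion K) p j P) →
        ∀ (bω bη : BdRPlusTop (v.adicCompletion K) p) (cP : (v.adicCompletion K)),
          (∀ τ, Pω (κ.1 τ) = BdRPlusTop.gal (v.adicCompletion K) p τ bω - bω) → (∀ τ, Pη (κ.1 τ) = BdRPlusTop.gal (v.adicCompletion K) p τ bη - bη) →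
          thetaBdR ((BdRPlusTop.of (v.adicCompletion K) p).symm bω) = algebraMap (v.adicCompletion K) (CompletedAlgClosure (v.adicCompletion K)) cP →
          ∀ N : ℕ,
            (∀ σ, IsTeichLog 2 ((BdRPlusTop.of (v.adicCompletion K) p).symm ((p : BdRPlusTop (v.adicCompletion K) p) ^ N *
              (BdRPlusTop.of (v.adicCompletion K) p (embBdRHom hpv hF cL⁻¹) * Pη (η.1 σ) * bω -
                Pω (η.1 σ) * (BdRPlusTop.of (v.adicCompletion K) p (embBdRHom hpv hF cL⁻¹) * bη))))) →
            (∀ M' : ℕ, ∀ᶠ σ in 𝓝 (1 : absoluteGaloisGroup (v.adicCompletion K)), ∃ L' : BDeRhamPlus (integerC (v.adicCompletion K)) p, IsTeichLog 2 L' ∧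
              (BdRPlusTop.of (v.adicCompletion K) p).symm ((p : BdRPlusTop (v.adicCompletion K) p) ^ N *
                (BdRPlusTop.of (v.adicCompletion K) p (embBdRHom hpv hF cL⁻¹) * Pη (η.1 σ) * bω -
                  Pω (η.1 σ) * (BdRPlusTop.of (v.adicCompletion K) p (embBdRHom hpv hF cL⁻¹) * bη))) -
                (p : BDeRhamPlus (integerC (v.adicCompletion K)) p) ^ M' * L' ∈ Ideal.span {(xiBdR : BDeRhamPlus (integerC (v.adicCompletion K)) p) ^ 2}) →
            ((tatePairingPoint (AinfTop.curveFO (v.adicCompletion K) (Wm.map ψm)) (v.adicCompletion K) p e hμ hadd₁ hadd₂ hgal hcompat (oneCocycleClass _ η) P : ℤ_[p]) : ℚ_[p]) =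
              -Algebra.trace ℚ_[p] (v.adicCompletion K) (cP * (expStarCoord (AinfTop.curveFO (v.adicCompletion K) (Wm.map ψm)) hpv d η * c)) :=
  exists_const_tatePairingPoint_eq_neg_trace_of_KTwo_of_matching v (AinfTop.curveFO (v.adicCompletion K) (Wm.map ψm)) e hμ hadd₁ hadd₂ hgal hcompat hpv Dv Wm ψm hψm _
    (em_canonical_smul v hpv Dv Wm ψm hp2 hΔ hA) hN1 hNη ψ hψ hψlog heL healt henondeg hinj hde d

/-! ### §2 The `T`-adic Kummer cocycle of a formal point is integrated by K1's pair -/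

omit [LocallyCompactSpace (absoluteGaloisGroup (HeightOneSpectrum.adicCompletion K v))] [Fact (¬ IsUnit (p : integerC (v.adicCompletion K)))]
  [IsAdicComplete (Ideal.span {(p : integerC (v.adicCompletion K))}) (integerC (v.adicCompletion K))] in
/-- **`em` carries the `T`-adic Kummer cocycle `κ_Q` to K1's `κ_u`** (`uₙ = z(Qₙ)`): `tateGeomEquivTatePtOSS_kummer` read through
`θ_∞⁻¹ ≫ θ_∞ = id`. [cite: SilvermanAEC2009, Prop. VII.2.2 and VIII §2] -/
theorem em_tadicKummer_eq_kummerCocycleO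
    {Q : ℕ → geomPoints ((AinfTop.curveFO (v.adicCompletion K) (Wm.map ψm)).baseChange (v.adicCompletion K))} (hQ : ∀ n, p • Q (n + 1) = Q n)
    (hfix : ∀ σ : absoluteGaloisGroup (v.adicCompletion K), σ • Q 0 = Q 0)
    (hker : ∀ n, AinfTop.geomToCO (Wm.map ψm) (Q n) ∈ kernel (NormedField.valuation (K := CompletedAlgClosure (v.adicCompletion K))) (curveOver (CompletedAlgClosure (v.adicCompletion K)) (Wm.map ψm)))
    (κ : contOneCocycles (restrictedTateRep (AinfTop.curveFO (v.adicCompletion K) (Wm.map ψm)) (v.adicCompletion K) p).toTopRep)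
    (hκ : ∀ σ, κ.1 σ = (tateModuleEquiv (AinfTop.curveFO (v.adicCompletion K) (Wm.map ψm)) (v.adicCompletion K) p).symm
      (TateModule.mk (fun n => σ • Q n - Q n) (pow_smul_gal_sub_divSeq_eq_zero (AinfTop.curveFO (v.adicCompletion K) (Wm.map ψm)) (v.adicCompletion K) p hQ hfix σ)
        (smul_gal_sub_divSeq_succ (AinfTop.curveFO (v.adicCompletion K) (Wm.map ψm)) (v.adicCompletion K) p hQ σ)))
    (τ : absoluteGaloisGroup (v.adicCompletion K)) :
    ((tateModuleEquiv (AinfTop.curveFO (v.adicCompletion K) (Wm.map ψm)) (v.adicCompletion K) p).trans (AinfTop.tateGeomEquivTatePtOSS (v.adicCompletion K) (Wm.map ψm) p hp2 hΔ hA)) (κ.1 τ) =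
      AinfRamTop.kummerCocycleO Wm ψm hψm (fun n => zPt (AinfTop.geomToCO (Wm.map ψm) (Q n)) (hker n))
        (AinfTop.mulPC_zPt_divSeqO Wm ψm hψm hQ hker) (AinfTop.galCBall_zPt_divSeqO_zero Wm ψm hfix hker) τ := by
  rw [hκ, LinearEquiv.trans_apply, LinearEquiv.apply_symm_apply]
  exact AinfTop.tateGeomEquivTatePtOSS_kummer Wm ψm hψm hp2 hΔ hA hQ hfix hker τ

omit [LocallyCompactSpace (absoluteGaloisGroup (HeightOneSpectrum.adicCompletion K v))] in
/-- **K1's `b_ω` (at any `Γ_F`-fixed lift `Q̂` of `u₀ = z(Q₀)`) integrates `∫ω ∘ em ∘ κ_Q`**, also after the shift by a `Γ_F`-invariant constant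
`ι(c_P)`: `∫ω(em(κ_Q τ)) = τ(b_ω + ι c_P) − (b_ω + ι c_P)`. [cite: BlochKato1990, Ex. 3.10.1, (3.11.1)] [cite: Kato1993LNM1553, Ch. II Lemma 1.4.3] -/
theorem omegaPeriodHomO_em_tadicKummer
    {Q : ℕ → geomPoints ((AinfTop.curveFO (v.adicCompletion K) (Wm.map ψm)).baseChange (v.adicCompletion K))} (hQ : ∀ n, p • Q (n + 1) = Q n)
    (hfix : ∀ σ : absoluteGaloisGroup (v.adicCompletion K), σ • Q 0 = Q 0)
    (hker : ∀ n, AinfTop.geomToCO (Wm.map ψm) (Q n) ∈ kernel (NormedField.valuation (K := CompletedAlgClosure (v.adicCompletion K))) (curveOver (CompletedAlgClosure (v.adicCompletion K)) (Wm.map ψm)))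
    (κ : contOneCocycles (restrictedTateRep (AinfTop.curveFO (v.adicCompletion K) (Wm.map ψm)) (v.adicCompletion K) p).toTopRep)
    (hκ : ∀ σ, κ.1 σ = (tateModuleEquiv (AinfTop.curveFO (v.adicCompletion K) (Wm.map ψm)) (v.adicCompletion K) p).symm
      (TateModule.mk (fun n => σ • Q n - Q n) (pow_smul_gal_sub_divSeq_eq_zero (AinfTop.curveFO (v.adicCompletion K) (Wm.map ψm)) (v.adicCompletion K) p hQ hfix σ)
        (smul_gal_sub_divSeq_succ (AinfTop.curveFO (v.adicCompletion K) (Wm.map ψm)) (v.adicCompletion K) p hQ σ)))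
    {Qhat : Wm.Pt (AinfRamTop.nilTheta Dv (surjective_fontaineTheta_integerC hpv))}
    (hQhat : AinfRamTop.thetaPt Wm (surjective_fontaineTheta_integerC hpv) Qhat = ⟨zPt (AinfTop.geomToCO (Wm.map ψm) (Q 0)) (hker 0)⟩)
    (hQhatσ : ∀ σ : absoluteGaloisGroup (v.adicCompletion K), AinfRamTop.galPtN Wm (surjective_fontaineTheta_integerC hpv) σ Qhat = Qhat)
    (cP : (v.adicCompletion K)) (τ : absoluteGaloisGroup (v.adicCompletion K)) :
    let hF := surjective_fontaineTheta_integerC hpv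
    let em : (AinfTop.curveFO (v.adicCompletion K) (Wm.map ψm)).tateModule p ≃ₗ[ℤ_[p]] AinfTop.TatePtO (v.adicCompletion K) (Wm.map ψm) p :=
      (tateModuleEquiv (AinfTop.curveFO (v.adicCompletion K) (Wm.map ψm)) (v.adicCompletion K) p).trans (AinfTop.tateGeomEquivTatePtOSS (v.adicCompletion K) (Wm.map ψm) p hp2 hΔ hA)
    let Pω : (AinfTop.curveFO (v.adicCompletion K) (Wm.map ψm)).tateModule p →+ BdRPlusTop (v.adicCompletion K) p := (AinfRamTop.omegaPeriodHomO Wm ψm hF hψm).comp em.toAddMonoidHom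
    Pω (κ.1 τ) =
      BdRPlusTop.gal (v.adicCompletion K) p τ (AinfRamTop.bOmega Wm (u := fun n => zPt (AinfTop.geomToCO (Wm.map ψm) (Q n)) (hker n))
          (AinfTop.mulPC_zPt_divSeqO Wm ψm hψm hQ hker) hQhat +
          BdRPlusTop.of (v.adicCompletion K) p (embBdRHom hpv hF cP)) -
        (AinfRamTop.bOmega Wm (u := fun n => zPt (AinfTop.geomToCO (Wm.map ψm) (Q n)) (hker n))
          (AinfTop.mulPC_zPt_divSeqO Wm ψm hψm hQ hker) hQhat + BdRPlusTop.of (v.adicCompletion K) p (embBdRHom hpv hF cP)) := by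
  intro hF em Pω
  change AinfRamTop.omegaPeriodHomO Wm ψm hF hψm (em (κ.1 τ)) = _
  rw [em_tadicKummer_eq_kummerCocycleO v hpv Dv Wm ψm hψm hp2 hΔ hA hQ hfix hker κ hκ τ, map_add, BdRPlusTop.gal_of,
    galBdRPlus_embBdRHom, add_sub_add_right_eq_sub]
  exact (AinfRamTop.gal_bOmega_sub_bOmega_eq_omegaPeriodHomO Wm ψm _ hQhat hQhatσ τ).symm

omit [LocallyCompactSpace (absoluteGaloisGroup (HeightOneSpectrum.adicCompletion K v))] in
/-- **K1's `b_η` integrates `∫η ∘ em ∘ κ_Q`**, also after a shift by a `Γ_F`-invariant constant `ι(c'_P)`. [cite: BlochKato1990, Ex. 3.10.1, (3.11.1)] [cite: Kato1993LNM1553, Ch. II Lemma 1.4.3] -/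
theorem etaPeriodHomO_em_tadicKummer
    {Q : ℕ → geomPoints ((AinfTop.curveFO (v.adicCompletion K) (Wm.map ψm)).baseChange (v.adicCompletion K))} (hQ : ∀ n, p • Q (n + 1) = Q n)
    (hfix : ∀ σ : absoluteGaloisGroup (v.adicCompletion K), σ • Q 0 = Q 0)
    (hker : ∀ n, AinfTop.geomToCO (Wm.map ψm) (Q n) ∈ kernel (NormedField.valuation (K := CompletedAlgClosure (v.adicCompletion K))) (curveOver (CompletedAlgClosure (v.adicCompletion K)) (Wm.map ψm)))
    (κ : contOneCocycles (restrictedTateRep (AinfTop.curveFO (v.adicCompletion K) (Wm.map ψm)) (v.adicCompletion K) p).toTopRep)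
    (hκ : ∀ σ, κ.1 σ = (tateModuleEquiv (AinfTop.curveFO (v.adicCompletion K) (Wm.map ψm)) (v.adicCompletion K) p).symm
      (TateModule.mk (fun n => σ • Q n - Q n) (pow_smul_gal_sub_divSeq_eq_zero (AinfTop.curveFO (v.adicCompletion K) (Wm.map ψm)) (v.adicCompletion K) p hQ hfix σ)
        (smul_gal_sub_divSeq_succ (AinfTop.curveFO (v.adicCompletion K) (Wm.map ψm)) (v.adicCompletion K) p hQ σ)))
    {Qhat : Wm.Pt (AinfRamTop.nilTheta Dv (surjective_fontaineTheta_integerC hpv))}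
    (hQhat : AinfRamTop.thetaPt Wm (surjective_fontaineTheta_integerC hpv) Qhat = ⟨zPt (AinfTop.geomToCO (Wm.map ψm) (Q 0)) (hker 0)⟩)
    (hQhatσ : ∀ σ : absoluteGaloisGroup (v.adicCompletion K), AinfRamTop.galPtN Wm (surjective_fontaineTheta_integerC hpv) σ Qhat = Qhat)
    (cP' : (v.adicCompletion K)) (τ : absoluteGaloisGroup (v.adicCompletion K)) :
    let hF := surjective_fontaineTheta_integerC hpv
    let em : (AinfTop.curveFO (v.adicCompletion K) (Wm.map ψm)).tateModule p ≃ₗ[ℤ_[p]] AinfTop.TatePtO (v.adicCompletion K) (Wm.map ψm) p :=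
      (tateModuleEquiv (AinfTop.curveFO (v.adicCompletion K) (Wm.map ψm)) (v.adicCompletion K) p).trans (AinfTop.tateGeomEquivTatePtOSS (v.adicCompletion K) (Wm.map ψm) p hp2 hΔ hA)
    let Pη : (AinfTop.curveFO (v.adicCompletion K) (Wm.map ψm)).tateModule p →+ BdRPlusTop (v.adicCompletion K) p := (AinfRamTop.etaPeriodHomO Wm ψm hF hψm).comp em.toAddMonoidHom
    Pη (κ.1 τ) =
      BdRPlusTop.gal (v.adicCompletion K) p τ (AinfRamTop.bEta Wm (u := fun n => zPt (AinfTop.geomToCO (Wm.map ψm) (Q n)) (hker n))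
          (AinfTop.mulPC_zPt_divSeqO Wm ψm hψm hQ hker) hQhat + BdRPlusTop.of (v.adicCompletion K) p (embBdRHom hpv hF cP')) -
        (AinfRamTop.bEta Wm (u := fun n => zPt (AinfTop.geomToCO (Wm.map ψm) (Q n)) (hker n))
          (AinfTop.mulPC_zPt_divSeqO Wm ψm hψm hQ hker) hQhat + BdRPlusTop.of (v.adicCompletion K) p (embBdRHom hpv hF cP')) := by
  intro hF em Pη
  change AinfRamTop.etaPeriodHomO Wm ψm hF hψm (em (κ.1 τ)) = _
  rw [em_tadicKummer_eq_kummerCocycleO v hpv Dv Wm ψm hψm hp2 hΔ hA hQ hfix hker κ hκ τ, map_add, BdRPlusTop.gal_of,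
    galBdRPlus_embBdRHom, add_sub_add_right_eq_sub]
  exact (AinfRamTop.gal_bEta_sub_bEta_eq_etaPeriodHomO Wm ψm _ hQhat hQhatσ τ).symm

omit [LocallyCompactSpace (absoluteGaloisGroup (HeightOneSpectrum.adicCompletion K v))] [CharP 𝓀[v.adicCompletion K] p]
  [(AinfTop.curveFO (v.adicCompletion K) (Wm.map ψm)).IsElliptic] in
/-- `θ(b_ω + ι c_P) = c_P` (`b_ω ∈ Fil¹ = ker θ`, `θ ∘ ι = id` on `F`). [cite: Fontaine1982FormesDifferentielles, §5] -/
theorem thetaBdR_bOmega_add_embBdRHom {u : ℕ → (maxNilIdealC (v.adicCompletion K)).toIdeal} (hup : ∀ n, AinfRamTop.mulPC Wm (u (n + 1)) = u n)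
    {Qhat : Wm.Pt (AinfRamTop.nilTheta Dv (surjective_fontaineTheta_integerC hpv))}
    (hQhat : AinfRamTop.thetaPt Wm (surjective_fontaineTheta_integerC hpv) Qhat = ⟨u 0⟩) (cP : (v.adicCompletion K)) :
    thetaBdR ((BdRPlusTop.of (v.adicCompletion K) p).symm (AinfRamTop.bOmega Wm hup hQhat +
        BdRPlusTop.of (v.adicCompletion K) p (embBdRHom hpv (surjective_fontaineTheta_integerC hpv) cP))) =
      algebraMap (v.adicCompletion K) (CompletedAlgClosure (v.adicCompletion K)) cP := by
  rw [map_add, RingEquiv.symm_apply_apply, map_add, thetaBdR_embBdRHom,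
    thetaBdR_eq_zero_of_mem_span (BdRPlusTop.mem_filOne_iff.1 (AinfRamTop.bOmega_mem_filOne Wm hup hQhat)), zero_add]

/-! ### §3 Kato's formula at a formal point modulo (K₂), everything else discharged -/

set_option maxHeartbeats 800000 in
/-- ★★★ **Kato's reciprocity law at `(η, P)` for a FORMAL point with `𝒪_D`-rational parameter, GRANTED ONLY (K₂).** Setting of
`exists_const_tatePairingPoint_eq_neg_trace_of_KTwo_canonical` (good `𝒪_D`-model `E = curveFO F W♭` at `F = K_v`, canonical matching,
cell data (N1′)/(Nη)/Weil tower/de Rham binders). ONE pair `(c_L ≠ 0, c)` such that for every cocycle `η`, every `P ∈ E(F)`, every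
`p`-power division sequence `Q` of `P` whose base is a formal point (`Q₀ ∈ E₁(ℂ_F)`) admitting a `Γ_F`-fixed lift `Q̂ ∈ Ŵ(𝔫_𝒪)` of its
parameter `z(Q₀)` (e.g. `AinfRamTop.coeffPt c` when `z(Q₀) = c ∈ 𝔪_D`), and all `c_P, c'_P ∈ F`: **(K₂) for the explicit pair
`(b_ω, b_η) = (bOmega + ι c_P, bEta + ι c'_P)` of K1 (any constants `c_P, c'_P ∈ F`) ⟹ `⟨[η], P⟩ = −Tr_{F/ℚ_p}(c_P · exp*_d(η) · c)`.** The `T`-adic Kummer cocycle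
(`LocalTatePairingKummerTadic`), its level classes, the matching and the integrating pair are all supplied by the tree; with
`c_P = log_ω P` the hypothesis (K₂) is Kato's Lemma 1.4.3 / BK Ex. 3.11 for the Legendre resolution (memo §2/§5) — the research residue.
[cite: Kato1993LNM1553, Ch. II Thm. 1.4.1 (3)–(4) and Lemma 1.4.3] [cite: BlochKato1990, Ex. 3.10.1, Example 3.11]
[cite: SilvermanAEC2009, Prop. VII.2.2 and VIII §2] -/
theorem tatePairingPoint_eq_neg_trace_of_KTwo_formalPoint
    (hN1 : ∃ τ, AinfRamTop.omegaPeriodHomO Wm ψm (surjective_fontaineTheta_integerC hpv) hψm τ ≠ 0)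
    (hNη : ∃ τ, AinfRamTop.etaPeriodHomO Wm ψm (surjective_fontaineTheta_integerC hpv) hψm τ ∉ (BdRPlusTop.filOne (v.adicCompletion K) p).toIdeal)
    (ψ : C(absoluteGaloisGroup (v.adicCompletion K), ℤ_[p])) (hψ : ∀ σ τ, ψ (σ * τ) = ψ σ + ψ τ)
    (hψlog : ∀ τ, (ψ τ : ℚ_[p]) = logCyclotomic (F := (v.adicCompletion K)) p τ)
    (heL : ∀ (c : ℤ_[p]) (S U : (AinfTop.curveFO (v.adicCompletion K) (Wm.map ψm)).tateModule p), (weilContPairingPadic (AinfTop.curveFO (v.adicCompletion K) (Wm.map ψm)) (v.adicCompletion K) p e hμ hadd₁ hadd₂ hgal hcompat).toLin (c • S) U =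
      twistHom (v.adicCompletion K) p ((weilContPairingPadic (AinfTop.curveFO (v.adicCompletion K) (Wm.map ψm)) (v.adicCompletion K) p e hμ hadd₁ hadd₂ hgal hcompat).toLin S U) c)
    (healt : ∀ S : (AinfTop.curveFO (v.adicCompletion K) (Wm.map ψm)).tateModule p, (weilContPairingPadic (AinfTop.curveFO (v.adicCompletion K) (Wm.map ψm)) (v.adicCompletion K) p e hμ hadd₁ hadd₂ hgal hcompat).toLin S S = 0)
    (henondeg : ∀ S : (AinfTop.curveFO (v.adicCompletion K) (Wm.map ψm)).tateModule p,
      (∀ U, (weilContPairingPadic (AinfTop.curveFO (v.adicCompletion K) (Wm.map ψm)) (v.adicCompletion K) p e hμ hadd₁ hadd₂ hgal hcompat).toLin S U = 0) → S = 0)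
    (hinj : letI := LocalField.padicAlgebra (v.adicCompletion K) p hpv
      (bdRPeriodRingData (F := (v.adicCompletion K)) (p := p) hpv).CupLogInjective (logCyclotomic p) (restrictedRationalTateRep (AinfTop.curveFO (v.adicCompletion K) (Wm.map ψm)) (v.adicCompletion K) p))
    (hde : letI := LocalField.padicAlgebra (v.adicCompletion K) p hpv
      ∀ η : contOneCocycles (restrictedTateRep (AinfTop.curveFO (v.adicCompletion K) (Wm.map ψm)) (v.adicCompletion K) p).toTopRep,
        (bdRPeriodRingData (F := (v.adicCompletion K)) (p := p) hpv).HasDualExp (logCyclotomic p) (restrictedRationalTateRep (AinfTop.curveFO (v.adicCompletion K) (Wm.map ψm)) (v.adicCompletion K) p)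
          fun σ => TateModule.toRational p (η.1 σ))
    (d : letI := LocalField.padicAlgebra (v.adicCompletion K) p hpv
      (bdRPeriodRingData (F := (v.adicCompletion K)) (p := p) hpv).FilZeroLine (restrictedRationalTateRep (AinfTop.curveFO (v.adicCompletion K) (Wm.map ψm)) (v.adicCompletion K) p)) :
    letI := LocalField.padicAlgebra (v.adicCompletion K) p hpv
    let hF := surjective_fontaineTheta_integerC hpv
    let em : (AinfTop.curveFO (v.adicCompletion K) (Wm.map ψm)).tateModule p ≃ₗ[ℤ_[p]] AinfTop.TatePtO (v.adicCompletion K) (Wm.map ψm) p :=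
      (tateModuleEquiv (AinfTop.curveFO (v.adicCompletion K) (Wm.map ψm)) (v.adicCompletion K) p).trans (AinfTop.tateGeomEquivTatePtOSS (v.adicCompletion K) (Wm.map ψm) p hp2 hΔ hA)
    let Pω : (AinfTop.curveFO (v.adicCompletion K) (Wm.map ψm)).tateModule p →+ BdRPlusTop (v.adicCompletion K) p := (AinfRamTop.omegaPeriodHomO Wm ψm hF hψm).comp em.toAddMonoidHom
    let Pη : (AinfTop.curveFO (v.adicCompletion K) (Wm.map ψm)).tateModule p →+ BdRPlusTop (v.adicCompletion K) p := (AinfRamTop.etaPeriodHomO Wm ψm hF hψm).comp em.toAddMonoidHom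
    ∃ (cL c : (v.adicCompletion K)), cL ≠ 0 ∧
      (∀ S U : (AinfTop.curveFO (v.adicCompletion K) (Wm.map ψm)).tateModule p, Pω S * Pη U - Pη S * Pω U = BdRPlusTop.of (v.adicCompletion K) p (embBdRHom hpv hF cL) *
        BdRPlusTop.periodLine (v.adicCompletion K) p ((weilContPairingPadic (AinfTop.curveFO (v.adicCompletion K) (Wm.map ψm)) (v.adicCompletion K) p e hμ hadd₁ hadd₂ hgal hcompat).toLin S U)) ∧
      ∀ (η : contOneCocycles (restrictedTateRep (AinfTop.curveFO (v.adicCompletion K) (Wm.map ψm)) (v.adicCompletion K) p).toTopRep) (P : ((AinfTop.curveFO (v.adicCompletion K) (Wm.map ψm)).baseChange (v.adicCompletion K)).toAffine.Point)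
        (Q : ℕ → geomPoints ((AinfTop.curveFO (v.adicCompletion K) (Wm.map ψm)).baseChange (v.adicCompletion K))) (hQ : ∀ n, p • Q (n + 1) = Q n) (hQ0 : Q 0 = toGeomPoints ((AinfTop.curveFO (v.adicCompletion K) (Wm.map ψm)).baseChange (v.adicCompletion K)) P)
        (hP1 : AinfTop.geomToCO (Wm.map ψm) (Q 0) ∈ kernel (NormedField.valuation (K := CompletedAlgClosure (v.adicCompletion K))) (curveOver (CompletedAlgClosure (v.adicCompletion K)) (Wm.map ψm)))
        (Qhat : Wm.Pt (AinfRamTop.nilTheta Dv hF))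
        (hQhat : AinfRamTop.thetaPt Wm hF Qhat =
          ⟨zPt (AinfTop.geomToCO (Wm.map ψm) (Q 0)) (AinfTop.geomToCO_divSeq_mem_kernel (Wm.map ψm) hp2 hΔ hA hQ hP1 0)⟩)
        (hQhatσ : ∀ σ : absoluteGaloisGroup (v.adicCompletion K), AinfRamTop.galPtN Wm hF σ Qhat = Qhat) (cP cP' : (v.adicCompletion K)) (N : ℕ),
        let bω : BdRPlusTop (v.adicCompletion K) p := AinfRamTop.bOmega Wm (u := fun n => zPt (AinfTop.geomToCO (Wm.map ψm) (Q n)) (AinfTop.geomToCO_divSeq_mem_kernel (Wm.map ψm) hp2 hΔ hA hQ hP1 n))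
          (AinfTop.mulPC_zPt_divSeqO Wm ψm hψm hQ (AinfTop.geomToCO_divSeq_mem_kernel (Wm.map ψm) hp2 hΔ hA hQ hP1)) hQhat + BdRPlusTop.of (v.adicCompletion K) p (embBdRHom hpv hF cP)
        let bη : BdRPlusTop (v.adicCompletion K) p := AinfRamTop.bEta Wm (u := fun n => zPt (AinfTop.geomToCO (Wm.map ψm) (Q n)) (AinfTop.geomToCO_divSeq_mem_kernel (Wm.map ψm) hp2 hΔ hA hQ hP1 n))
          (AinfTop.mulPC_zPt_divSeqO Wm ψm hψm hQ (AinfTop.geomToCO_divSeq_mem_kernel (Wm.map ψm) hp2 hΔ hA hQ hP1)) hQhat +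
          BdRPlusTop.of (v.adicCompletion K) p (embBdRHom hpv hF cP')
        (∀ σ, IsTeichLog 2 ((BdRPlusTop.of (v.adicCompletion K) p).symm ((p : BdRPlusTop (v.adicCompletion K) p) ^ N *
          (BdRPlusTop.of (v.adicCompletion K) p (embBdRHom hpv hF cL⁻¹) * Pη (η.1 σ) * bω -
            Pω (η.1 σ) * (BdRPlusTop.of (v.adicCompletion K) p (embBdRHom hpv hF cL⁻¹) * bη))))) →
        (∀ M' : ℕ, ∀ᶠ σ in 𝓝 (1 : absoluteGaloisGroup (v.adicCompletion K)), ∃ L' : BDeRhamPlus (integerC (v.adicCompletion K)) p, IsTeichLog 2 L' ∧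
          (BdRPlusTop.of (v.adicCompletion K) p).symm ((p : BdRPlusTop (v.adicCompletion K) p) ^ N *
            (BdRPlusTop.of (v.adicCompletion K) p (embBdRHom hpv hF cL⁻¹) * Pη (η.1 σ) * bω -
              Pω (η.1 σ) * (BdRPlusTop.of (v.adicCompletion K) p (embBdRHom hpv hF cL⁻¹) * bη))) -
            (p : BDeRhamPlus (integerC (v.adicCompletion K)) p) ^ M' * L' ∈ Ideal.span {(xiBdR : BDeRhamPlus (integerC (v.adicCompletion K)) p) ^ 2}) →
        ((tatePairingPoint (AinfTop.curveFO (v.adicCompletion K) (Wm.map ψm)) (v.adicCompletion K) p e hμ hadd₁ hadd₂ hgal hcompat (oneCocycleClass _ η) P : ℤ_[p]) : ℚ_[p]) =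
          -Algebra.trace ℚ_[p] (v.adicCompletion K) (cP * (expStarCoord (AinfTop.curveFO (v.adicCompletion K) (Wm.map ψm)) hpv d η * c)) := by
  intro hF em Pω Pη
  -- the hypotheses of the generic capstone for `(Pω, Pη) = (∫ω ∘ em, ∫η ∘ em)` (as in `…_of_matching`, `em` canonical)
  have hem : ∀ (σ : absoluteGaloisGroup (v.adicCompletion K)) (a : (AinfTop.curveFO (v.adicCompletion K) (Wm.map ψm)).tateModule p),
      em (absGaloisRestrict (v.adicCompletion K) (v.adicCompletion K) σ • a) = σ • em a := em_canonical_smul v hpv Dv Wm ψm hp2 hΔ hA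
  have hPωapp : ∀ a, Pω a = AinfRamTop.omegaPeriodHomO Wm ψm hF hψm (em a) := fun _ => rfl
  have hPηapp : ∀ a, Pη a = AinfRamTop.etaPeriodHomO Wm ψm hF hψm (em a) := fun _ => rfl
  have hPωZ : ∀ (c : ℤ_[p]) (a : (AinfTop.curveFO (v.adicCompletion K) (Wm.map ψm)).tateModule p), Pω (c • a) = BdRPlusTop.of (v.adicCompletion K) p (qpToBdR (c : ℚ_[p])) * Pω a :=
    fun c a => by rw [hPωapp, hPωapp, map_smul, AinfRamTop.omegaPeriodHomO_smul']
  have hPηZ : ∀ (c : ℤ_[p]) (a : (AinfTop.curveFO (v.adicCompletion K) (Wm.map ψm)).tateModule p), Pη (c • a) = BdRPlusTop.of (v.adicCompletion K) p (qpToBdR (c : ℚ_[p])) * Pη a :=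
    fun c a => by rw [hPηapp, hPηapp, map_smul, AinfRamTop.etaPeriodHomO_smul']
  have hPω : ∀ (σ : absoluteGaloisGroup (v.adicCompletion K)) (a : (AinfTop.curveFO (v.adicCompletion K) (Wm.map ψm)).tateModule p),
      BdRPlusTop.gal (v.adicCompletion K) p σ (Pω a) = Pω (restrictedTateRep (AinfTop.curveFO (v.adicCompletion K) (Wm.map ψm)) (v.adicCompletion K) p σ a) := fun σ a => by
    rw [hPωapp, hPωapp, AinfRamTop.gal_omegaPeriodHomO, restrictedTateRep_apply_apply, hem]
  have hPη : ∀ (σ : absoluteGaloisGroup (v.adicCompletion K)) (a : (AinfTop.curveFO (v.adicCompletion K) (Wm.map ψm)).tateModule p),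
      BdRPlusTop.gal (v.adicCompletion K) p σ (Pη a) = Pη (restrictedTateRep (AinfTop.curveFO (v.adicCompletion K) (Wm.map ψm)) (v.adicCompletion K) p σ a) := fun σ a => by
    rw [hPηapp, hPηapp, AinfRamTop.gal_etaPeriodHomO, restrictedTateRep_apply_apply, hem]
  have hfil : ∀ a, Pω a ∈ (BdRPlusTop.filOne (v.adicCompletion K) p).toIdeal := fun a => by
    rw [hPωapp]; exact AinfRamTop.omegaPeriodHomO_mem_filOne Wm ψm _
  have hne : ∃ a, Pω a ≠ 0 := by
    obtain ⟨τ, hτ⟩ := hN1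
    exact ⟨em.symm τ, by rwa [hPωapp, LinearEquiv.apply_symm_apply]⟩
  have hnot : ∃ a, Pη a ∉ (BdRPlusTop.filOne (v.adicCompletion K) p).toIdeal := by
    obtain ⟨τ, hτ⟩ := hNη
    exact ⟨em.symm τ, by rwa [hPηapp, LinearEquiv.apply_symm_apply]⟩
  obtain ⟨cL, c, hcL, hLeg, hmain⟩ := exists_const_tatePairingPoint_eq_neg_trace_of_KTwo v (AinfTop.curveFO (v.adicCompletion K) (Wm.map ψm)) e hμ hadd₁ hadd₂ hgal hcompat hpv hF
    ψ hψ hψlog hPωZ hPηZ hPω hPη hfil hne hnot heL healt henondeg hinj hde d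
  refine ⟨cL, c, hcL, hLeg, ?_⟩
  intro η P Q hQ hQ0 hP1 Qhat hQhat hQhatσ cP cP' N bω bη hX hXs
  have hfix : ∀ σ : absoluteGaloisGroup (v.adicCompletion K), σ • Q 0 = Q 0 := gal_smul_divSeq_zero (AinfTop.curveFO (v.adicCompletion K) (Wm.map ψm)) (v.adicCompletion K) hQ0
  have hker := AinfTop.geomToCO_divSeq_mem_kernel (Wm.map ψm) hp2 hΔ hA hQ hP1
  obtain ⟨κ, hκ⟩ := exists_contOneCocycles_tadicKummer (AinfTop.curveFO (v.adicCompletion K) (Wm.map ψm)) (v.adicCompletion K) p hQ hfix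
  have h1 := cohomologyMap_tateProjMor_oneCocycleClass_eq_kummerLevelClass (AinfTop.curveFO (v.adicCompletion K) (Wm.map ψm)) (v.adicCompletion K) p hQ hQ0 κ hκ
  have h2 : ∀ τ, Pω (κ.1 τ) = BdRPlusTop.gal (v.adicCompletion K) p τ bω - bω :=
    omegaPeriodHomO_em_tadicKummer v hpv Dv Wm ψm hψm hp2 hΔ hA hQ hfix hker κ hκ hQhat hQhatσ cP
  have h3 : ∀ τ, Pη (κ.1 τ) = BdRPlusTop.gal (v.adicCompletion K) p τ bη - bη :=
    etaPeriodHomO_em_tadicKummer v hpv Dv Wm ψm hψm hp2 hΔ hA hQ hfix hker κ hκ hQhat hQhatσ cP'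
  have h4 : thetaBdR ((BdRPlusTop.of (v.adicCompletion K) p).symm bω) = algebraMap (v.adicCompletion K) (CompletedAlgClosure (v.adicCompletion K)) cP :=
    thetaBdR_bOmega_add_embBdRHom v hpv Dv Wm (u := fun n => zPt (AinfTop.geomToCO (Wm.map ψm) (Q n)) (hker n))
      (AinfTop.mulPC_zPt_divSeqO Wm ψm hψm hQ hker) hQhat cP
  exact hmain η κ P h1 bω bη cP h2 h3 h4 N hX hXs
end Completion

end Literature.NumberTheory.PAdicHodge

end
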